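/-
Copyright (c) 2026. All rights reserved.
Released under Apache 2.0 license as described in the file LICENSE.
Authors: HodgeCM publication cell (pub-hodgecm), model-construction sub-cell, construction prover `mc-weil-1`.
-/
import Literature.NumberTheory.Automorphic.TateLocalSchwartzBruhat
import Literature.NumberTheory.Automorphic.LocalFieldHaarBalls

/-!
# Tate's local Fourier inversion and the self-dual Haar measure (non-archimedean place)

Topic `NumberTheory/Automorphic`; namespace `Literature.NumberTheory.Automorphic`.

KERNEL discharge of the tree's cited record `IsSelfDualMeasure ψ μ` ("`(f̂)̂(x) = f(-x)` for `f ∈ 𝒮(F)`",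
Tate 1950, §2.2 Thm 2.2.2) at a non-archimedean place, for EVERY continuous non-trivial `ψ`:

* §1 step functions: cosets `a + 𝔭^N`, and the decomposition of a Schwartz–Bruhat function `f`, invariant under
  `𝔭^N`, as the finite sum `f = Σ_B f(a_B) 1_B` over distinct cosets `B = a_B + 𝔭^N` (`exists_finset_eq_sum_indicator`);
* §2 the explicit transforms `(1_{a+𝔭^N})^ = μ(𝔭^N) ψ(a·) 1_{𝔭^{m-N}}` and
  `(ψ(a·) 1_{𝔭^n})^(z) = μ(𝔭^n) 1_{𝔭^{m-n}}(a + z)` (`m` = conductor exponent of `ψ`), whence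
  `((1_{a+𝔭^N})^)^ = μ(𝔭^N) μ(𝔭^{m-N}) · 1_{a+𝔭^N}(-·)` and `μ(𝔭^N) μ(𝔭^{m-N}) = q^{-m} μ(𝒪)²` (`selfDualConst`);
* §3 **inversion with constant** `fourierSB_fourierSB_eq`: for every Haar `μ` and `f ∈ 𝒮(F)`,
  `(f̂)̂ = q^{-m} μ(𝒪)² · f(-·)` — so `IsSelfDualMeasure ψ μ ↔ q^{-m} μ(𝒪)² = 1` (`isSelfDualMeasure_iff`);
* §4 **existence** `exists_isSelfDualMeasure`: the rescaling `selfDualSMul μ m = (q^{-m} μ(𝒪)²)^{-1/2} · μ` of any Haar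
  measure is a self-dual Haar measure (`isSelfDualMeasure_selfDualSMul`); applied to Mathlib's `addHaar`, a self-dual
  Haar measure EXISTS for every continuous non-trivial `ψ`, with no further hypothesis.

Consequently the hypothesis `(hμ : IsSelfDualMeasure ψ μ)` of the rank-one local Weil representation files
(`RepresentationTheory/HeisenbergGroup/TateWeylPair`, `RankOneGeneration`, …) is instantiable by a theorem, not a citation.
-/

set_option autoImplicit false

noncomputable section

namespace Literature.NumberTheory.Automorphic

open _root_.MeasureTheory
open Literature.NumberTheory.GaloisRepresentations.IsNonarchimedeanLocalField
open scoped Pointwise NNReal ENNReal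

variable {F : Type*} [Field F] [ValuativeRel F] [TopologicalSpace F] [IsNonarchimedeanLocalField F]

/-! ## §1 Cosets of balls; step functions -/

section Steps

/-- `v ∈ a + 𝔭^N ↔ v - a ∈ 𝔭^N`. [folklore] -/
theorem mem_vadd_primePowBall_iff {N : ℤ} {a v : F} :
    v ∈ a +ᵥ primePowBall F N ↔ v - a ∈ primePowBall F N := by
  rw [Set.mem_vadd_set_iff_neg_vadd_mem, vadd_eq_add, neg_add_eq_sub]

/-- `a ∈ a + 𝔭^N`. [folklore] -/
theorem self_mem_vadd_primePowBall (N : ℤ) (a : F) : a ∈ a +ᵥ primePowBall F N := by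
  rw [mem_vadd_primePowBall_iff, sub_self]; exact zero_mem_primePowBall N

/-- two cosets of `𝔭^N` that meet are equal. [folklore] -/
theorem vadd_primePowBall_eq_of_mem {N : ℤ} {a u : F} (hu : u ∈ a +ᵥ primePowBall F N) :
    u +ᵥ primePowBall F N = a +ᵥ primePowBall F N := by
  rw [mem_vadd_primePowBall_iff] at hu
  ext v
  rw [mem_vadd_primePowBall_iff, mem_vadd_primePowBall_iff]
  constructor
  · intro hv
    have e : v - a = (v - u) + (u - a) := by ring
    rw [e]; exact add_mem_primePowBall hv hu
  · intro hv
    have e : v - u = (v - a) + -(u - a) := by ring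
    rw [e]; exact add_mem_primePowBall hv (neg_mem_primePowBall hu)

/-- `-z ∈ a + 𝔭^N ↔ a + z ∈ 𝔭^N`. [folklore] -/
theorem neg_mem_vadd_primePowBall_iff {N : ℤ} {a z : F} :
    -z ∈ a +ᵥ primePowBall F N ↔ a + z ∈ primePowBall F N := by
  rw [mem_vadd_primePowBall_iff]
  constructor
  · intro h
    have := neg_mem_primePowBall h
    rwa [neg_sub, sub_neg_eq_add] at this
  · intro h
    have := neg_mem_primePowBall h
    rwa [neg_add, add_comm, ← sub_eq_add_neg] at this

/-- a coset of `𝔭^N` is compact. [folklore] -/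
theorem isCompact_vadd_primePowBall (N : ℤ) (a : F) : IsCompact (a +ᵥ primePowBall F N) :=
  (isCompact_primePowBall N).vadd a

/-- a coset of `𝔭^N` is open. [folklore] -/
theorem isOpen_vadd_primePowBall (N : ℤ) (a : F) : IsOpen (a +ᵥ primePowBall F N) :=
  (isOpen_primePowBall N).vadd a

/-- invariance under `𝔭^N` persists for `N' ≥ N`. [folklore] -/
theorem forall_add_eq_of_le {f : F → ℂ} {N N' : ℤ} (h : N ≤ N')
    (hf : ∀ x, ∀ t ∈ primePowBall F N, f (x + t) = f x) : ∀ x, ∀ t ∈ primePowBall F N', f (x + t) = f x :=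
  fun x t ht => hf x t (primePowBall_antitone h ht)

/-- `1_{𝔭^N}` is `𝔭^{N'}`-invariant for `N' ≥ N`. [folklore] -/
theorem indicator_primePowBall_add_eq {N N' : ℤ} (h : N ≤ N') (x : F) {t : F} (ht : t ∈ primePowBall F N') :
    (primePowBall F N).indicator (fun _ => (1 : ℂ)) (x + t) = (primePowBall F N).indicator (fun _ => (1 : ℂ)) x := by
  have ht' : t ∈ primePowBall F N := primePowBall_antitone h ht
  by_cases hx : x ∈ primePowBall F N
  · rw [Set.indicator_of_mem hx, Set.indicator_of_mem (add_mem_primePowBall hx ht')]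
  · rw [Set.indicator_of_notMem hx, Set.indicator_of_notMem]
    intro hx'
    apply hx
    have := add_mem_primePowBall hx' (neg_mem_primePowBall ht')
    rwa [add_neg_cancel_right] at this

/-- on a coset of `𝔭^N` a `𝔭^N`-invariant `f` is the constant `f(a)`: `1_B f = f(a) 1_B`. [folklore] -/
theorem indicator_vadd_primePowBall_eq {f : F → ℂ} {N : ℤ} (hf : ∀ x, ∀ t ∈ primePowBall F N, f (x + t) = f x)
    {a : F} {B : Set F} (hB : B = a +ᵥ primePowBall F N) (u : F) :
    B.indicator f u = f a * B.indicator (fun _ => (1 : ℂ)) u := by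
  by_cases hu : u ∈ B
  · rw [Set.indicator_of_mem hu, Set.indicator_of_mem hu, mul_one]
    rw [hB, mem_vadd_primePowBall_iff] at hu
    have := hf a (u - a) hu
    rwa [add_sub_cancel] at this
  · rw [Set.indicator_of_notMem hu, Set.indicator_of_notMem hu, mul_zero]

/-- **step decomposition**: a Schwartz–Bruhat function is a finite sum `Σ_B 1_B f` over (distinct, hence disjoint)
cosets `B` of `𝔭^N` — a finite subcover of its compact support. [cite: BushnellHenniart2006, §23.1] -/
theorem exists_finset_eq_sum_indicator {f : F → ℂ} (hf : f ∈ SchwartzBruhat F) (N : ℤ) :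
    ∃ C : Finset (Set F), (∀ B ∈ C, ∃ a : F, B = a +ᵥ primePowBall F N) ∧
      ∀ u, f u = ∑ B ∈ C, B.indicator f u := by
  classical
  obtain ⟨-, hcs⟩ := (mem_schwartzBruhat_iff).1 hf
  obtain ⟨A, hA⟩ := IsCompact.elim_finite_subcover hcs (fun a : F => a +ᵥ primePowBall F N)
    (fun a => (isOpen_primePowBall N).vadd a) (fun a _ => Set.mem_iUnion.2 ⟨a, self_mem_vadd_primePowBall N a⟩)
  refine ⟨A.image fun a => a +ᵥ primePowBall F N, ?_, fun u => ?_⟩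
  · intro B hB
    obtain ⟨a, -, rfl⟩ := Finset.mem_image.1 hB
    exact ⟨a, rfl⟩
  · by_cases hu : ∃ a ∈ A, u ∈ a +ᵥ primePowBall F N
    · obtain ⟨a, ha, hua⟩ := hu
      rw [Finset.sum_eq_single_of_mem (a +ᵥ primePowBall F N)
        (Finset.mem_image_of_mem (fun a : F => a +ᵥ primePowBall F N) ha)]
      · rw [Set.indicator_of_mem hua]
      · intro B hB hne
        obtain ⟨a', -, rfl⟩ := Finset.mem_image.1 hB
        rw [Set.indicator_of_notMem]
        intro hu'
        exact hne ((vadd_primePowBall_eq_of_mem hu').symm.trans (vadd_primePowBall_eq_of_mem hua))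
    · push Not at hu
      have hu0 : f u = 0 := by
        refine image_eq_zero_of_notMem_tsupport fun h => ?_
        obtain ⟨a, ha, hua⟩ := Set.mem_iUnion₂.1 (hA h)
        exact hu a ha hua
      rw [hu0, eq_comm]
      refine Finset.sum_eq_zero fun B hB => ?_
      obtain ⟨a, ha, rfl⟩ := Finset.mem_image.1 hB
      exact Set.indicator_of_notMem (hu a ha) _

/-- **step decomposition with constants**: a Schwartz–Bruhat function is `Σ_B f(a_B) 1_B` over finitely many distinct
cosets `B = a_B + 𝔭^N`, for every `N` past its invariance exponent. [cite: BushnellHenniart2006, §23.1] -/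
theorem exists_finset_eq_sum_const_mul_indicator {f : F → ℂ} (hf : f ∈ SchwartzBruhat F) :
    ∃ (N : ℤ) (C : Finset (Set F)) (rep : Set F → F), (∀ B ∈ C, B = rep B +ᵥ primePowBall F N) ∧
      ∀ u, f u = ∑ B ∈ C, f (rep B) * B.indicator (fun _ => (1 : ℂ)) u := by
  classical
  obtain ⟨N, hN⟩ := exists_forall_add_eq_of_mem_schwartzBruhat hf
  obtain ⟨C, hC, hsum⟩ := exists_finset_eq_sum_indicator hf N
  choose! rep hrep using hC
  refine ⟨N, C, rep, hrep, fun u => ?_⟩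
  rw [hsum u]
  exact Finset.sum_congr rfl fun B hB => indicator_vadd_primePowBall_eq hN (hrep B hB) u

end Steps

/-! ## §2 Explicit transforms of coset indicators -/

section Transforms

variable [MeasurableSpace F] [BorelSpace F] (μ : Measure F) {ψ : AddChar F Circle} {m : ℤ}

omit [BorelSpace F] in
/-- a coset of `𝔭^N` is measurable (it is open). [folklore] -/
theorem measurableSet_vadd_primePowBall [OpensMeasurableSpace F] (N : ℤ) (a : F) :
    MeasurableSet (a +ᵥ primePowBall F N) :=
  (isOpen_vadd_primePowBall N a).measurableSet

omit [ValuativeRel F] [TopologicalSpace F] [IsNonarchimedeanLocalField F] [BorelSpace F] in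
/-- constants come out of the Fourier transform: `(c·g)^ = c·ĝ` (no integrability needed). [folklore] -/
private theorem fourierSB_const_mul_aux (ψ : AddChar F Circle) (c : ℂ) (g : F → ℂ) :
    fourierSB ψ μ (fun x => c * g x) = fun y => c * fourierSB ψ μ g y := by
  funext y
  rw [fourierSB_apply, fourierSB_apply, ← integral_const_mul]
  refine integral_congr_ae (Filter.Eventually.of_forall fun x => ?_)
  simp only
  ring

omit [ValuativeRel F] [IsNonarchimedeanLocalField F] [BorelSpace F] in
/-- finite sums come out of the Fourier transform (each summand integrable). [folklore] -/
theorem fourierSB_finset_sum [IsTopologicalRing F] [OpensMeasurableSpace F] {ψ : AddChar F Circle}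
    (hψc : Continuous ψ) {ι : Type*} (s : Finset ι)
    (g : ι → F → ℂ) (hg : ∀ i ∈ s, Integrable (g i) μ) :
    fourierSB ψ μ (fun x => ∑ i ∈ s, g i x) = fun y => ∑ i ∈ s, fourierSB ψ μ (g i) y := by
  funext y
  rw [fourierSB_apply]
  simp_rw [Finset.mul_sum, fourierSB_apply]
  refine integral_finsetSum s fun i hi => ?_
  refine (hg i hi).bdd_mul (c := 1) ?_ (Filter.Eventually.of_forall fun x => ?_)
  · exact (continuous_subtype_val.comp (hψc.comp (continuous_id.mul continuous_const))).aestronglyMeasurable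
  · rw [Circle.norm_coe]

variable [μ.IsAddHaarMeasure]

open scoped Classical in
/-- **`(1_{a+𝔭^N})^(y) = ψ(a y) · μ(𝔭^N) · 1_{𝔭^{m-N}}(y)`** (Tate 1950, §2.5, the transforms of translated
characteristic functions). [cite: Tate1950, §2.5] -/
theorem fourierSB_indicator_vadd_primePowBall (hm : ψ.HasConductorExp m) (a : F) (N : ℤ) (y : F) :
    fourierSB ψ μ ((a +ᵥ primePowBall F N).indicator fun _ => (1 : ℂ)) y =
      ((ψ (a * y) : Circle) : ℂ) *
        (if y ∈ primePowBall F (m - N) then (μ.real (primePowBall F N) : ℂ) else 0) := by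
  classical
  rw [fourierSB_apply, ← setIntegral_primePowBall_addChar_mul μ hm N y,
    ← integral_indicator (measurableSet_primePowBall N), ← integral_const_mul,
    ← integral_add_left_eq_self _ a]
  refine integral_congr_ae (Filter.Eventually.of_forall fun x => ?_)
  simp only
  by_cases hx : x ∈ primePowBall F N
  · have hx' : a + x ∈ a +ᵥ primePowBall F N := Set.mem_vadd_set.2 ⟨x, hx, rfl⟩
    rw [Set.indicator_of_mem hx', Set.indicator_of_mem hx, add_mul, AddChar.map_add_eq_mul, Circle.coe_mul,
      mul_one]
  · have hx' : a + x ∉ a +ᵥ primePowBall F N := fun h' => by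
      obtain ⟨x', hx'', h⟩ := Set.mem_vadd_set.1 h'
      rw [vadd_eq_add, add_right_inj] at h
      exact hx (h ▸ hx'')
    rw [Set.indicator_of_notMem hx', Set.indicator_of_notMem hx, mul_zero, mul_zero]

open scoped Classical in
/-- **`(ψ(a·) 1_{𝔭^n})^(z) = μ(𝔭^n) · 1_{𝔭^{m-n}}(a + z)`** (Tate 1950, §2.5, the computation of `f̂_n`).
[cite: Tate1950, §2.5] -/
theorem fourierSB_addChar_mul_left_indicator_primePowBall (hm : ψ.HasConductorExp m) (a : F) (n : ℤ) (z : F) :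
    fourierSB ψ μ (fun x => ((ψ (a * x) : Circle) : ℂ) * (primePowBall F n).indicator (fun _ => (1 : ℂ)) x) z =
      if a + z ∈ primePowBall F (m - n) then (μ.real (primePowBall F n) : ℂ) else 0 := by
  classical
  rw [fourierSB_apply, ← setIntegral_primePowBall_addChar_mul μ hm n (a + z),
    ← integral_indicator (measurableSet_primePowBall n)]
  refine integral_congr_ae (Filter.Eventually.of_forall fun x => ?_)
  simp only
  by_cases hx : x ∈ primePowBall F n
  · rw [Set.indicator_of_mem hx, Set.indicator_of_mem hx, mul_one, mul_add, AddChar.map_add_eq_mul,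
      Circle.coe_mul, mul_comm (a : F) x, mul_comm (((ψ (x * z) : Circle) : ℂ))]
  · rw [Set.indicator_of_notMem hx, Set.indicator_of_notMem hx, mul_zero, mul_zero]

variable (m) in
/-- the **self-duality constant** `q^{-m} μ(𝒪)²` of a Haar measure `μ` relative to a character of conductor exponent
`m`. [cite: Tate1950, §2.2 Thm. 2.2.2] -/
def selfDualConst : ℝ :=
  ((residueFieldCard F : ℝ)⁻¹) ^ m * μ.real (primePowBall F 0) ^ 2

/-- `μ(𝔭^N) μ(𝔭^{m-N}) = q^{-m} μ(𝒪)²`. [folklore] -/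
theorem measureReal_mul_measureReal_eq_selfDualConst (N : ℤ) :
    μ.real (primePowBall F N) * μ.real (primePowBall F (m - N)) = selfDualConst μ m := by
  have hq : ((residueFieldCard F : ℝ)⁻¹) ≠ 0 :=
    inv_ne_zero (Nat.cast_ne_zero.2 (residueFieldCard_ne_zero F))
  rw [LocalFieldHaar.measureReal_primePowBall μ N, LocalFieldHaar.measureReal_primePowBall μ (m - N), selfDualConst]
  rw [show ((residueFieldCard F : ℝ)⁻¹) ^ m = ((residueFieldCard F : ℝ)⁻¹) ^ N * ((residueFieldCard F : ℝ)⁻¹) ^ (m - N) by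
    rw [← zpow_add₀ hq, add_sub_cancel]]
  ring

/-- `0 < q^{-m} μ(𝒪)²`. [folklore] -/
theorem selfDualConst_pos : 0 < selfDualConst μ m := by
  rw [← measureReal_mul_measureReal_eq_selfDualConst μ 0]
  exact mul_pos (LocalFieldHaar.measureReal_primePowBall_pos μ 0) (LocalFieldHaar.measureReal_primePowBall_pos μ _)

/-- **double transform of a coset indicator**: `((1_{a+𝔭^N})^)^ = q^{-m} μ(𝒪)² · 1_{a+𝔭^N}(-·)`.
[cite: Tate1950, §2.2 Thm. 2.2.2] -/
theorem fourierSB_fourierSB_indicator_vadd_primePowBall (hm : ψ.HasConductorExp m) (a : F) (N : ℤ) :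
    fourierSB ψ μ (fourierSB ψ μ ((a +ᵥ primePowBall F N).indicator fun _ => (1 : ℂ))) =
      fun z => (selfDualConst μ m : ℂ) * (a +ᵥ primePowBall F N).indicator (fun _ => (1 : ℂ)) (-z) := by
  classical
  have h1 : fourierSB ψ μ ((a +ᵥ primePowBall F N).indicator fun _ => (1 : ℂ)) =
      fun y => (μ.real (primePowBall F N) : ℂ) *
        (((ψ (a * y) : Circle) : ℂ) * (primePowBall F (m - N)).indicator (fun _ => (1 : ℂ)) y) := by
    funext y
    rw [fourierSB_indicator_vadd_primePowBall μ hm a N y]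
    by_cases hy : y ∈ primePowBall F (m - N)
    · rw [if_pos hy, Set.indicator_of_mem hy]; ring
    · rw [if_neg hy, Set.indicator_of_notMem hy]; ring
  rw [h1, fourierSB_const_mul_aux]
  funext z
  rw [fourierSB_addChar_mul_left_indicator_primePowBall μ hm a (m - N) z, sub_sub_cancel,
    ← measureReal_mul_measureReal_eq_selfDualConst μ N, Complex.ofReal_mul]
  by_cases hz : a + z ∈ primePowBall F N
  · rw [if_pos hz, Set.indicator_of_mem (neg_mem_vadd_primePowBall_iff.2 hz), mul_one]
  · rw [if_neg hz, Set.indicator_of_notMem (fun h => hz (neg_mem_vadd_primePowBall_iff.1 h)), mul_zero, mul_zero]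

end Transforms

/-! ## §3 Fourier inversion with constant; §4 the self-dual Haar measure -/

section Inversion

variable [MeasurableSpace F] [BorelSpace F] (μ : Measure F) [μ.IsAddHaarMeasure] {ψ : AddChar F Circle} {m : ℤ}

/-- an indicator of a coset times a constant is integrable (compact, finite Haar measure). [folklore] -/
theorem integrable_const_mul_indicator_vadd_primePowBall (c : ℂ) (a : F) (N : ℤ) :
    Integrable (fun u => c * (a +ᵥ primePowBall F N).indicator (fun _ => (1 : ℂ)) u) μ := by
  have h : (fun u => c * (a +ᵥ primePowBall F N).indicator (fun _ => (1 : ℂ)) u) =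
      (a +ᵥ primePowBall F N).indicator (fun _ => c) := by
    funext u
    by_cases hu : u ∈ a +ᵥ primePowBall F N
    · rw [Set.indicator_of_mem hu, Set.indicator_of_mem hu, mul_one]
    · rw [Set.indicator_of_notMem hu, Set.indicator_of_notMem hu, mul_zero]
  rw [h, integrable_indicator_iff (measurableSet_vadd_primePowBall N a)]
  haveI : T2Space F := (GaloisRepresentations.IsNonarchimedeanLocalField.isLocalField F).toT2Space
  exact continuousOn_const.integrableOn_compact (isCompact_vadd_primePowBall N a)

/-- the transform of a coset indicator is integrable (a character times the indicator of a ball).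
[cite: Tate1950, §2.5] -/
theorem integrable_fourierSB_indicator_vadd_primePowBall (hψc : Continuous ψ) (hm : ψ.HasConductorExp m) (a : F)
    (N : ℤ) : Integrable (fourierSB ψ μ ((a +ᵥ primePowBall F N).indicator fun _ => (1 : ℂ))) μ := by
  classical
  have h : fourierSB ψ μ ((a +ᵥ primePowBall F N).indicator fun _ => (1 : ℂ)) =
      (primePowBall F (m - N)).indicator fun y => ((ψ (a * y) : Circle) : ℂ) * (μ.real (primePowBall F N) : ℂ) := by
    funext y
    rw [fourierSB_indicator_vadd_primePowBall μ hm a N y]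
    by_cases hy : y ∈ primePowBall F (m - N)
    · rw [if_pos hy, Set.indicator_of_mem hy]
    · rw [if_neg hy, Set.indicator_of_notMem hy, mul_zero]
  rw [h, integrable_indicator_iff (measurableSet_primePowBall (m - N))]
  haveI : T2Space F := (GaloisRepresentations.IsNonarchimedeanLocalField.isLocalField F).toT2Space
  refine ContinuousOn.integrableOn_compact (isCompact_primePowBall (m - N)) ?_
  exact ((continuous_subtype_val.comp (hψc.comp (continuous_const.mul continuous_id))).mul
    continuous_const).continuousOn

/-- **Tate's local Fourier inversion formula with its constant** (Tate 1950, Thm 2.2.2 at a `𝔭`-adic place): for every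
additive Haar measure `μ`, every continuous `ψ` of conductor exponent `m` and every `f ∈ 𝒮(F)`,
`(f̂)̂(x) = q^{-m} μ(𝒪)² · f(-x)`. Proof: step decomposition + the explicit transforms of §2.
[cite: Tate1950, §2.2 Thm. 2.2.2] -/
theorem fourierSB_fourierSB_eq (hψc : Continuous ψ) (hm : ψ.HasConductorExp m) {f : F → ℂ}
    (hf : f ∈ SchwartzBruhat F) :
    fourierSB ψ μ (fourierSB ψ μ f) = fun x => (selfDualConst μ m : ℂ) * f (-x) := by
  classical
  obtain ⟨N, C, rep, hrep, hsum⟩ := exists_finset_eq_sum_const_mul_indicator hf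
  have hfeq : f = fun u => ∑ B ∈ C, f (rep B) * (rep B +ᵥ primePowBall F N).indicator (fun _ => (1 : ℂ)) u := by
    funext u
    rw [hsum u]
    exact Finset.sum_congr rfl fun B hB => by rw [← hrep B hB]
  have step1 : fourierSB ψ μ f =
      fun y => ∑ B ∈ C, f (rep B) * fourierSB ψ μ ((rep B +ᵥ primePowBall F N).indicator fun _ => (1 : ℂ)) y := by
    conv_lhs => rw [hfeq]
    rw [fourierSB_finset_sum μ hψc C _ fun B _ =>
      integrable_const_mul_indicator_vadd_primePowBall μ (f (rep B)) (rep B) N]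
    funext y
    exact Finset.sum_congr rfl fun B _ => by rw [fourierSB_const_mul_aux]
  rw [step1, fourierSB_finset_sum μ hψc C _ fun B _ =>
    (integrable_fourierSB_indicator_vadd_primePowBall μ hψc hm (rep B) N).const_mul (f (rep B))]
  funext z
  rw [hsum (-z), Finset.mul_sum]
  refine Finset.sum_congr rfl fun B hB => ?_
  rw [fourierSB_const_mul_aux, fourierSB_fourierSB_indicator_vadd_primePowBall μ hm (rep B) N]
  simp only
  rw [← hrep B hB]
  ring

/-- **criterion**: a Haar measure `μ` is self-dual for `ψ` (conductor exponent `m`) iff `q^{-m} μ(𝒪)² = 1`, i.e.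
`μ(𝒪) = q^{m/2}` (Tate 1950, §2.2: "`dξ` = the measure for which `𝔬` gets measure `(N𝔡)^{-1/2}`", transported to
`ψ` of conductor `𝔭^m`). [cite: Tate1950, §2.2 Thm. 2.2.2] -/
theorem isSelfDualMeasure_iff (hψc : Continuous ψ) (hm : ψ.HasConductorExp m) :
    IsSelfDualMeasure ψ μ ↔ selfDualConst μ m = 1 := by
  classical
  constructor
  · intro h
    have h1 := congr_fun (h _ (indicator_primePowBall_mem_schwartzBruhat 0 (1 : ℂ))) 0
    rw [fourierSB_fourierSB_eq μ hψc hm (indicator_primePowBall_mem_schwartzBruhat 0 (1 : ℂ))] at h1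
    simp only [neg_zero, Set.indicator_of_mem (zero_mem_primePowBall 0), mul_one] at h1
    exact_mod_cast h1
  · intro h f hf
    rw [fourierSB_fourierSB_eq μ hψc hm hf, h, Complex.ofReal_one]
    funext x
    rw [one_mul]

omit [Field F] [ValuativeRel F] [TopologicalSpace F] [IsNonarchimedeanLocalField F] [BorelSpace F]
  [μ.IsAddHaarMeasure] in
/-- rescaling a measure rescales `μ.real`. [folklore] -/
theorem measureReal_ennreal_smul (c : ℝ≥0∞) (s : Set F) : (c • μ).real s = c.toReal * μ.real s := by
  rw [measureReal_def, Measure.smul_apply, smul_eq_mul, ENNReal.toReal_mul, measureReal_def]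

/-- the **self-dual rescaling** `μ_ψ := (q^{-m} μ(𝒪)²)^{-1/2} · μ` of a Haar measure `μ` (so that `μ_ψ(𝒪) = q^{m/2}`).
[cite: Tate1950, §2.2 Thm. 2.2.2] -/
def selfDualSMul (μ : Measure F) (m : ℤ) : Measure F :=
  ENNReal.ofReal (Real.sqrt (selfDualConst μ m))⁻¹ • μ

/-- the self-dual rescaling of a Haar measure is a Haar measure. [folklore] -/
instance isAddHaarMeasure_selfDualSMul : (selfDualSMul μ m).IsAddHaarMeasure := by
  refine Measure.IsAddHaarMeasure.smul _ ?_ ENNReal.ofReal_ne_top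
  rw [Ne, ENNReal.ofReal_eq_zero, not_le]
  exact inv_pos.2 (Real.sqrt_pos.2 (selfDualConst_pos μ))

/-- the self-dual rescaling has self-duality constant `1`. [folklore] -/
theorem selfDualConst_selfDualSMul : selfDualConst (selfDualSMul μ m) m = 1 := by
  have hKpos : 0 < selfDualConst μ m := selfDualConst_pos μ
  have hcr : (ENNReal.ofReal (Real.sqrt (selfDualConst μ m))⁻¹).toReal = (Real.sqrt (selfDualConst μ m))⁻¹ :=
    ENNReal.toReal_ofReal (inv_nonneg.2 (Real.sqrt_nonneg _))
  rw [selfDualConst, selfDualSMul, measureReal_ennreal_smul, hcr, mul_pow, ← mul_assoc, mul_comm (_ ^ m), mul_assoc]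
  rw [show ((residueFieldCard F : ℝ)⁻¹) ^ m * μ.real (primePowBall F 0) ^ 2 = selfDualConst μ m from rfl, inv_pow,
    Real.sq_sqrt hKpos.le, inv_mul_cancel₀ hKpos.ne']

/-- **the self-dual rescaling IS self-dual**: `(f̂)̂ = f(-·)` on `𝒮(F)` for `μ_ψ`, `ψ` continuous of conductor
exponent `m`. [cite: Tate1950, §2.2 Thm. 2.2.2] -/
theorem isSelfDualMeasure_selfDualSMul (hψc : Continuous ψ) (hm : ψ.HasConductorExp m) :
    IsSelfDualMeasure ψ (selfDualSMul μ m) :=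
  (isSelfDualMeasure_iff (selfDualSMul μ m) hψc hm).2 (selfDualConst_selfDualSMul μ)

end Inversion

section Existence

variable [MeasurableSpace F] [BorelSpace F] {ψ : AddChar F Circle}

/-- **existence of the self-dual Haar measure** (Tate 1950, Thm 2.2.2: "with our choice of measure, the inversion
formula holds"): for every continuous non-trivial `ψ` of a non-archimedean local field `F` there is an additive Haar
measure `ν` on `F` with `(f̂)̂(x) = f(-x)` for all `f ∈ 𝒮(F)` — the self-dual rescaling of Mathlib's `addHaar`
(`F` is locally compact). No hypothesis beyond `ψ` continuous and non-trivial. [cite: Tate1950, §2.2 Thm. 2.2.2] -/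
theorem exists_isSelfDualMeasure (hψ : ψ.IsContinuousNontrivial) :
    ∃ ν : Measure F, ν.IsAddHaarMeasure ∧ IsSelfDualMeasure ψ ν := by
  haveI : LocallyCompactSpace F :=
    (GaloisRepresentations.IsNonarchimedeanLocalField.isLocalField F).toLocallyCompactSpace
  obtain ⟨m, hm⟩ := hψ.exists_hasConductorExp
  exact ⟨selfDualSMul Measure.addHaar m, inferInstance, isSelfDualMeasure_selfDualSMul _ hψ.1 hm⟩

end Existence


end Literature.NumberTheory.Automorphic
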